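import Mathlib

/-!
# TropicalLinks / InductiveStep — the centre of a valuation does not depend on the chart

Route `ResolutionOfSingularities/TropicalLinks`, crux `InductiveStep` (stmt-ResolutionOfSingularities-17233),
line `split`, brick UC (producer), in support of stage 1/2 of the geometric producer
`stub_mainLemma`.

Setting: `k` a field, `K` a field extension, `f' : Fin (n+1) → K` the homogeneous coordinates (as
elements of the function field `K`) of a projective variety `Ȳ ⊆ ℙⁿ`.  For an index `h` with
`f'_h ≠ 0` the chart subalgebra `𝒞_h := k[f'_j / f'_h : j] ⊆ K` is the coordinate ring of the affine
chart `Ȳ ∩ D₊(X_h)`.  A valuation ring `V` of `K` containing two charts `𝒞_h, 𝒞_{h'}` has a centre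
on each, and the local ring at the centre — the set of fractions `a / s` with `a, s` in the chart
ring and `v(s) = 1` — is the *same* subset of `K` for both charts (a valuation ring dominates at
most one point: `Ȳ` is separated).

* `tropicalLinks_centre_chart_mul_pow_mem` — padding: for `a ∈ 𝒞_h` there is `D` with
  `a · ρ' ^ D ∈ 𝒞_{h'}`, where `ρ' := f'_h / f'_{h'} ∈ 𝒞_{h'}` (induction over `Algebra.adjoin`:
  a generator `f'_j / f'_h` satisfies `(f'_j / f'_h) · ρ' = f'_j / f'_{h'}`, so `D = 1`; constants
  `D = 0`; sums are padded to a common exponent using `ρ' ∈ 𝒞_{h'}`; products add exponents).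
* `tropicalLinks_centre_chart_valuation_eq_one` — `v(ρ') = 1`: both `ρ'` and its inverse
  `ρ = f'_{h'} / f'_h ∈ 𝒞_h` lie in `V`.
* `tropicalLinks_centre_chart_subset` — one inclusion: `a / s = (a ρ'^D) / (s ρ'^D)` with both
  padded elements in `𝒞_{h'}` and `v(s ρ'^D) = v(s) v(ρ')^D = 1`.
* `tropicalLinks_centre_chart_independent` — **the two local rings coincide** (both inclusions, by
  symmetry in `h, h'`).

Mathlib only.
-/

-- single-problem summit: the doubled namespace component `ResolutionOfSingularities` is forced
set_option linter.dupNamespace false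

namespace Summit.ResolutionOfSingularities.ResolutionOfSingularities.Theorems

/-- **Padding into the other chart.** For fields `k ⊆ K`, coordinates `f' : Fin (n+1) → K` and
indices `h, h'` with `f'_h, f'_{h'} ≠ 0`, every `a ∈ k[f'_j / f'_h : j]` satisfies
`a · (f'_h / f'_{h'}) ^ D ∈ k[f'_j / f'_{h'} : j]` for some `D : ℕ`: a generator needs `D = 1`
(`(f'_j / f'_h) · (f'_h / f'_{h'}) = f'_j / f'_{h'}`), a constant `D = 0`, a sum is padded to a
common exponent with the generator `f'_h / f'_{h'}`, and a product adds the exponents. [folklore] -/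
theorem tropicalLinks_centre_chart_mul_pow_mem
    (k : Type) [Field k] (K : Type) [Field K] [Algebra k K] (n : ℕ) (f' : Fin (n + 1) → K)
    (h h' : Fin (n + 1)) (hh : f' h ≠ 0) (a : K)
    (ha : a ∈ Algebra.adjoin k (Set.range fun j : Fin (n + 1) => f' j * (f' h)⁻¹)) :
    ∃ D : ℕ, a * (f' h * (f' h')⁻¹) ^ D ∈
      Algebra.adjoin k (Set.range fun j : Fin (n + 1) => f' j * (f' h')⁻¹) := by
  set S' : Subalgebra k K := Algebra.adjoin k (Set.range fun j : Fin (n + 1) => f' j * (f' h')⁻¹)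
    with hS'
  -- the generator `ρ' = f'_h / f'_{h'}` of the `h'`-chart
  have hρ' : f' h * (f' h')⁻¹ ∈ S' :=
    Algebra.subset_adjoin (R := k) (s := Set.range fun j : Fin (n + 1) => f' j * (f' h')⁻¹) ⟨h, rfl⟩
  induction ha using Algebra.adjoin_induction with
  | mem x hx =>
    obtain ⟨j, rfl⟩ := hx
    refine ⟨1, ?_⟩
    have hxj : f' j * (f' h)⁻¹ * (f' h * (f' h')⁻¹) ^ 1 = f' j * (f' h')⁻¹ := by
      rw [pow_one, mul_assoc, ← mul_assoc (f' h)⁻¹, inv_mul_cancel₀ hh, one_mul]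
    rw [hxj]
    exact Algebra.subset_adjoin (R := k)
      (s := Set.range fun j : Fin (n + 1) => f' j * (f' h')⁻¹) ⟨j, rfl⟩
  | algebraMap r =>
    refine ⟨0, ?_⟩
    rw [pow_zero, mul_one]
    exact S'.algebraMap_mem r
  | add x y _ _ hx hy =>
    obtain ⟨D₁, h₁⟩ := hx
    obtain ⟨D₂, h₂⟩ := hy
    refine ⟨D₁ + D₂, ?_⟩
    rw [add_mul]
    refine add_mem ?_ ?_
    · rw [pow_add, ← mul_assoc]
      exact mul_mem h₁ (pow_mem hρ' _)
    · rw [add_comm D₁, pow_add, ← mul_assoc]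
      exact mul_mem h₂ (pow_mem hρ' _)
  | mul x y _ _ hx hy =>
    obtain ⟨D₁, h₁⟩ := hx
    obtain ⟨D₂, h₂⟩ := hy
    refine ⟨D₁ + D₂, ?_⟩
    rw [pow_add, mul_mul_mul_comm]
    exact mul_mem h₁ h₂

/-- **The transition function is a unit of the valuation ring.** If a valuation subring `V` of `K`
contains both chart rings `k[f'_j / f'_h : j]` and `k[f'_j / f'_{h'} : j]` (with `f'_h, f'_{h'} ≠ 0`),
then `v(f'_h / f'_{h'}) = 1` for the valuation `v` of `V`: both `f'_h / f'_{h'}` and its inverse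
`f'_{h'} / f'_h` are chart generators, hence lie in `V`, so both have valuation `≤ 1` while their
product has valuation `1`. [folklore] -/
theorem tropicalLinks_centre_chart_valuation_eq_one
    (k : Type) [Field k] (K : Type) [Field K] [Algebra k K] (n : ℕ) (f' : Fin (n + 1) → K)
    (V : ValuationSubring K) (h h' : Fin (n + 1)) (hh : f' h ≠ 0) (hh' : f' h' ≠ 0)
    (hV : (Algebra.adjoin k (Set.range fun j : Fin (n + 1) => f' j * (f' h)⁻¹)).toSubring ≤
      V.toSubring)
    (hV' : (Algebra.adjoin k (Set.range fun j : Fin (n + 1) => f' j * (f' h')⁻¹)).toSubring ≤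
      V.toSubring) :
    V.valuation (f' h * (f' h')⁻¹) = 1 := by
  -- `ρ = f'_{h'} / f'_h ∈ 𝒞_h ⊆ V` and `ρ' = f'_h / f'_{h'} ∈ 𝒞_{h'} ⊆ V`
  have hρV : f' h' * (f' h)⁻¹ ∈ V :=
    hV (Algebra.subset_adjoin (R := k) (s := Set.range fun j : Fin (n + 1) => f' j * (f' h)⁻¹)
      ⟨h', rfl⟩)
  have hρ'V : f' h * (f' h')⁻¹ ∈ V :=
    hV' (Algebra.subset_adjoin (R := k) (s := Set.range fun j : Fin (n + 1) => f' j * (f' h')⁻¹)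
      ⟨h, rfl⟩)
  have hρle : V.valuation (f' h' * (f' h)⁻¹) ≤ 1 := (V.valuation_le_one_iff _).2 hρV
  have hρ'le : V.valuation (f' h * (f' h')⁻¹) ≤ 1 := (V.valuation_le_one_iff _).2 hρ'V
  have hprod : f' h' * (f' h)⁻¹ * (f' h * (f' h')⁻¹) = 1 := by
    rw [mul_mul_mul_comm, mul_comm (f' h') (f' h), ← mul_mul_mul_comm, mul_inv_cancel₀ hh,
      mul_inv_cancel₀ hh', one_mul]
  refine le_antisymm hρ'le ?_
  calc (1 : _) = V.valuation (f' h' * (f' h)⁻¹) * V.valuation (f' h * (f' h')⁻¹) := by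
        rw [← map_mul, hprod, map_one]
    _ ≤ 1 * V.valuation (f' h * (f' h')⁻¹) := mul_le_mul_left hρle _
    _ = V.valuation (f' h * (f' h')⁻¹) := one_mul _

/-- **One inclusion of chart independence.** With notation as above, every fraction `a / s` with
`a, s ∈ k[f'_j / f'_h : j]` and `v(s) = 1` is also a fraction `a' / s'` with
`a', s' ∈ k[f'_j / f'_{h'} : j]` and `v(s') = 1`: pad numerator and denominator by a common power
`ρ' ^ D` of the transition function `ρ' = f'_h / f'_{h'}` (which has valuation `1` and is nonzero),
`a / s = (a ρ'^D) / (s ρ'^D)`. [folklore] -/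
theorem tropicalLinks_centre_chart_subset
    (k : Type) [Field k] (K : Type) [Field K] [Algebra k K] (n : ℕ) (f' : Fin (n + 1) → K)
    (V : ValuationSubring K) (h h' : Fin (n + 1)) (hh : f' h ≠ 0) (hh' : f' h' ≠ 0)
    (hV : (Algebra.adjoin k (Set.range fun j : Fin (n + 1) => f' j * (f' h)⁻¹)).toSubring ≤
      V.toSubring)
    (hV' : (Algebra.adjoin k (Set.range fun j : Fin (n + 1) => f' j * (f' h')⁻¹)).toSubring ≤
      V.toSubring) :
    {x : K | ∃ a s : K, a ∈ Algebra.adjoin k (Set.range fun j : Fin (n + 1) => f' j * (f' h)⁻¹) ∧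
      s ∈ Algebra.adjoin k (Set.range fun j : Fin (n + 1) => f' j * (f' h)⁻¹) ∧
      V.valuation s = 1 ∧ x = a / s} ⊆
    {x : K | ∃ a s : K, a ∈ Algebra.adjoin k (Set.range fun j : Fin (n + 1) => f' j * (f' h')⁻¹) ∧
      s ∈ Algebra.adjoin k (Set.range fun j : Fin (n + 1) => f' j * (f' h')⁻¹) ∧
      V.valuation s = 1 ∧ x = a / s} := by
  rintro x ⟨a, s, ha, hs, hvs, rfl⟩
  have hρ'S' : f' h * (f' h')⁻¹ ∈
      Algebra.adjoin k (Set.range fun j : Fin (n + 1) => f' j * (f' h')⁻¹) :=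
    Algebra.subset_adjoin (R := k) (s := Set.range fun j : Fin (n + 1) => f' j * (f' h')⁻¹) ⟨h, rfl⟩
  have hρ'0 : f' h * (f' h')⁻¹ ≠ 0 := mul_ne_zero hh (inv_ne_zero hh')
  have hvρ' : V.valuation (f' h * (f' h')⁻¹) = 1 :=
    tropicalLinks_centre_chart_valuation_eq_one k K n f' V h h' hh hh' hV hV'
  obtain ⟨D₁, h₁⟩ := tropicalLinks_centre_chart_mul_pow_mem k K n f' h h' hh a ha
  obtain ⟨D₂, h₂⟩ := tropicalLinks_centre_chart_mul_pow_mem k K n f' h h' hh s hs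
  refine ⟨a * (f' h * (f' h')⁻¹) ^ D₁ * (f' h * (f' h')⁻¹) ^ D₂,
    s * (f' h * (f' h')⁻¹) ^ D₂ * (f' h * (f' h')⁻¹) ^ D₁,
    mul_mem h₁ (pow_mem hρ'S' D₂), mul_mem h₂ (pow_mem hρ'S' D₁), ?_, ?_⟩
  · simp only [map_mul, map_pow, hvs, hvρ', one_pow, one_mul]
  · rw [mul_assoc, mul_assoc, ← pow_add, ← pow_add, add_comm D₂ D₁,
      mul_div_mul_right _ _ (pow_ne_zero _ hρ'0)]

/-- **The centre of a valuation does not depend on the chart (separatedness of the projective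
closure).** For fields `k ⊆ K`, homogeneous coordinates `f' : Fin (n+1) → K`, a valuation subring
`V` of `K` and two indices `h, h'` with `f'_h, f'_{h'} ≠ 0` such that `V` contains both chart rings
`𝒞_h = k[f'_j / f'_h : j]` and `𝒞_{h'} = k[f'_j / f'_{h'} : j]`, the local rings of the two centres —
the fractions `a / s` with `a, s` in the chart ring and `v(s) = 1` — are the same subset of `K`.
Both inclusions are `tropicalLinks_centre_chart_subset`, by symmetry in `h, h'`. [folklore] -/
theorem tropicalLinks_centre_chart_independent : ∀ (k : Type) [Field k] (K : Type) [Field K] [Algebra k K] (n : ℕ) (f' : Fin (n + 1) → K) (V : ValuationSubring K) (h h' : Fin (n + 1)), f' h ≠ 0 → f' h' ≠ 0 → (Algebra.adjoin k (Set.range fun j : Fin (n + 1) => f' j * (f' h)⁻¹)).toSubring ≤ V.toSubring → (Algebra.adjoin k (Set.range fun j : Fin (n + 1) => f' j * (f' h')⁻¹)).toSubring ≤ V.toSubring → {x : K | ∃ a s : K, a ∈ Algebra.adjoin k (Set.range fun j : Fin (n + 1) => f' j * (f' h)⁻¹) ∧ s ∈ Algebra.adjoin k (Set.range fun j : Fin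 (n + 1) => f' j * (f' h)⁻¹) ∧ V.valuation s = 1 ∧ x = a / s} = {x : K | ∃ a s : K, a ∈ Algebra.adjoin k (Set.range fun j : Fin (n + 1) => f' j * (f' h')⁻¹) ∧ s ∈ Algebra.adjoin k (Set.range fun j : Fin (n + 1) => f' j * (f' h')⁻¹) ∧ V.valuation s = 1 ∧ x = a / s} := by
  intro k _ K _ _ n f' V h h' hh hh' hV hV'
  exact Set.Subset.antisymm
    (tropicalLinks_centre_chart_subset k K n f' V h h' hh hh' hV hV')
    (tropicalLinks_centre_chart_subset k K n f' V h' h hh' hh hV' hV)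

end Summit.ResolutionOfSingularities.ResolutionOfSingularities.Theorems
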